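import Summits.AtomisticToContinuum.Crystallization.Theorems.FrustratedLawDichotomyStrainedPatchSectorTransportA

/-!
# Aperiodic strained patch — SECTOR TRANSPORT across the affine recut, PART B (cell decomp-a2c-lens-5, g104; SECTOR-104)

PART A (`…SectorTransportA`) typed `RWRecut` / `RecutStable` and the generic DOOR-Tᴬ supplier with a transported class folded
into the target.  This part transports the WINDOW clause of the shear-aware door and assembles the record cells consumed by
`…AperiodicGapRecordJunctionHysteresis` (#41, target-decoupled sectoring):

* §4 the Gram window under `G ↦ (1+A)G` (`‖A‖ ≤ α`): scale `d₁ ↦ (1+α)d₁`, dilation literals `ν, μ` UNCHANGED (scale-free),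
  shear literal `δ ↦ (δ + (2α+α²)(1+μ)²)/(1+α)²` — an ABSOLUTE collar of width `≈ 2α = 3/80` on the (S)-line (finding
  SHEAR-COLLAR-104: at the record `α = 3/160` a door literal `δ = 0.023` transports to `≈ 0.060`, i.e. the transported door `𝓡⁺`
  reaches hosts softer than the STIFF46 (S)-line; the door table `B₁` must be certified on `famAnd CompFamilyW 𝓡⁺`).  The source
  window predicate is the UNIVERSAL one, `WinRW Wf Wh` («every RW presentation in the interior box has its generating map in the
  window»), which sits inside the record (existential) `IsWindowBall Wf Wh bends0 (133/10)` on RW hosts (`isWindowBall_of_winRW`);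
  the target predicate is the record existential one over `bends1`.  (Equality of the two source predicates is presentation
  rigidity of RW hosts — true, not needed, not typed.)
* §5 record cells for #41: DOOR cell `BalancedRefit (famAnd (famAnd 𝓘₀ (Dense dA)) 𝓡ᵁ) (famAnd CompFamilyW 𝓡⁺) (affBal (24/5)) …
  tauA (affTol (1/25) (1/52))` with `𝓡ᵁ := famAnd (Door (24/25) (9/100)) (WinRW (GramWindow (24/25) ν μ δ) (GramWindow (24/25) νh μh δh))`
  and `𝓡⁺ := ShearDoorGram (489/500) (9/100) bends1 ν μ δ⁺ νh μh δh⁺` (`489/500 = (163/160)(24/25)`; goodness literal `9/100`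
  NOT inflated — the target is `eta30 = 7/100`-good; window radius `133/10` unchanged; bending class `bends0 ↦ bends1`);
  BAND cell `… (famAnd CompFamilyW (Dense dB⁺)) …` with `(163/160)·dB ≤ dB⁺` (record `dB = 1009/1000 ↦ 257/250`).
* §6 vacuity: with `𝓣D := famAnd 𝓣 𝓡⁺` the target classes `famAnd (famAndNot 𝓣D 𝓡⁺) 𝓟` and `famAndNot (famAndNot 𝓣D 𝓡⁺) 𝓟` are
  EMPTY, and a `PairKernelCert` / `SlavingEnclosureG` over an empty family holds — so #41's per-class certificates `hPD₂`, `hPD₃`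
  (and `hPB₃` for `𝓣B := famAnd 𝓣 (Dense dB⁺)`) are discharged here, not by the census; in the alternative instantiation
  («collar read at `B₂`»: table classes keyed by the RECORD door `𝓡rec`, `𝓟' := Dense dB⁺ ⊇ 𝓡⁺`) class 3 is empty by
  confinement (`not_famAndNot_famAndNot_of_le`, `famAnd_shearDoorGram_le_dense`) and only the collar class 2 is a census item.

[formal bookkeeping] throughout; no new mathematics.
-/

noncomputable section

namespace Summit.AtomisticToContinuum.Crystallization.Theorems.FrustratedLawDichotomyStrainedPatchSectorTransport

open scoped BigOperators Classical RealInnerProductSpace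
open Summit.AtomisticToContinuum.Crystallization.Theorems.ChargedEnergyGapNegative (E3)
open Summit.AtomisticToContinuum.Crystallization.Theorems.FrustratedLawDichotomyPeriodicBlockFlags (goodAtScale_mono)
open Summit.AtomisticToContinuum.Crystallization.Theorems.FrustratedLawDichotomyRangeCut (Sep)
open Summit.AtomisticToContinuum.Crystallization.Theorems.FrustratedLawDichotomyMotifLemmas (GoodAtScale)
open Summit.AtomisticToContinuum.Crystallization.Theorems.FrustratedLawDichotomyAveragingCut (ball mem_ball)
open Summit.AtomisticToContinuum.Crystallization.Theorems.FrustratedLawDichotomyStrainedPatchHomSplit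
open Summit.AtomisticToContinuum.Crystallization.Theorems.FrustratedLawDichotomyStrainedPatchCleanCollar (CleanBall)
open Summit.AtomisticToContinuum.Crystallization.Theorems.FrustratedLawDichotomyStrainedPatchPhaseCut (MonoPhaseBall)
open Summit.AtomisticToContinuum.Crystallization.Theorems.FrustratedLawDichotomyStrainedPatchCoreTube (NearHomIsoAt)
open Summit.AtomisticToContinuum.Crystallization.Theorems.FrustratedLawDichotomyStrainedPatchChartFamilies (ChartBy FamilyLE)
open Summit.AtomisticToContinuum.Crystallization.Theorems.FrustratedLawDichotomyStrainedPatchChartFamiliesBent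
open Summit.AtomisticToContinuum.Crystallization.Theorems.FrustratedLawDichotomyStrainedPatchChartFamiliesPinned
open Summit.AtomisticToContinuum.Crystallization.Theorems.FrustratedLawDichotomyStrainedPatchEnvelopeLaw (dev bends1)
open Summit.AtomisticToContinuum.Crystallization.Theorems.FrustratedLawDichotomyStrainedPatchQuantSlaving
open Summit.AtomisticToContinuum.Crystallization.Theorems.FrustratedLawDichotomyStrainedPatchGradedTube
open Summit.AtomisticToContinuum.Crystallization.Theorems.FrustratedLawDichotomyStrainedPatchPairTube (PairTab lowLevel)
open Summit.AtomisticToContinuum.Crystallization.Theorems.FrustratedLawDichotomyStrainedPatchWindowFamilies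
open Summit.AtomisticToContinuum.Crystallization.Theorems.FrustratedLawDichotomyStrainedPatchRecutPairs
open Summit.AtomisticToContinuum.Crystallization.Theorems.FrustratedLawDichotomyStrainedPatchRecutKinematics
open Summit.AtomisticToContinuum.Crystallization.Theorems.FrustratedLawDichotomyStrainedPatchRecutBuild
open Summit.AtomisticToContinuum.Crystallization.Theorems.FrustratedLawDichotomyStrainedPatchRecutRecord
open Summit.AtomisticToContinuum.Crystallization.Theorems.FrustratedLawDichotomyStrainedPatchRecutChart
open Summit.AtomisticToContinuum.Crystallization.Theorems.FrustratedLawDichotomyStrainedPatchRecutLevel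
open Summit.AtomisticToContinuum.Crystallization.Theorems.FrustratedLawDichotomyStrainedPatchKernelCut
open Summit.AtomisticToContinuum.Crystallization.Theorems.FrustratedLawDichotomyStrainedPatchStiffSector
open Summit.AtomisticToContinuum.Crystallization.Theorems.FrustratedLawDichotomyStrainedPatchStiffDoor
open Summit.AtomisticToContinuum.Crystallization.Theorems.FrustratedLawDichotomyStrainedPatchShearDoor
open Summit.AtomisticToContinuum.Crystallization.Theorems.FrustratedLawDichotomyStrainedPatchAffineCut

variable {M₀ M₁ : ℕ}

/-! ## §4. Transport of the window clause -/

/-- A presented chart whose generating map is in the window is a window ball (…RecutPairs `isBentBall_of_presentedBy` with the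
window clause carried). [formal bookkeeping] -/
theorem isWindowBall_of_presentedBy {Wf Wh : (E3 →L[ℝ] E3) → Prop} {𝓑 : Set (E3 → E3)} {φ : Bool} {b : E3 → E3} {G : E3 →L[ℝ] E3}
    {ξ : E3} {R : ℝ} {M : ℕ} {z₁ : Fin M → E3} {c₁ : Fin M} (hb : b ∈ 𝓑) (h : PresentedBy φ b G ξ R z₁ c₁) (hw : cond φ (Wf G) (Wh G)) :
    IsWindowBall Wf Wh 𝓑 R z₁ c₁ := by
  obtain ⟨hG, hξ, z₀, hr, hab⟩ := h
  refine ⟨b, z₀, G, ξ, hb, hG, hξ, ?_, hab⟩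
  cases φ
  · exact Or.inr ⟨by simpa only [homRange, cond_false] using hr, hw⟩
  · exact Or.inl ⟨by simpa only [homRange, cond_true] using hr, hw⟩

/-- `|⟪(1+A)u, (1+A)v⟫ − ⟪u, v⟫| ≤ (2α + α²)·‖u‖·‖v‖` for `‖A‖ ≤ α`. [formal bookkeeping] -/
theorem abs_inner_one_add_sub_le (A : E3 →L[ℝ] E3) {α : ℝ} (hA : ‖A‖ ≤ α) (u v : E3) :
    |⟪((1 : E3 →L[ℝ] E3) + A) u, ((1 : E3 →L[ℝ] E3) + A) v⟫ - ⟪u, v⟫| ≤ (2 * α + α ^ 2) * (‖u‖ * ‖v‖) := by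
  have hα0 : 0 ≤ α := (norm_nonneg A).trans hA
  have hAu : ‖A u‖ ≤ α * ‖u‖ := (A.le_opNorm u).trans (mul_le_mul_of_nonneg_right hA (norm_nonneg _))
  have hAv : ‖A v‖ ≤ α * ‖v‖ := (A.le_opNorm v).trans (mul_le_mul_of_nonneg_right hA (norm_nonneg _))
  have hu : ((1 : E3 →L[ℝ] E3) + A) u = u + A u := rfl
  have hv : ((1 : E3 →L[ℝ] E3) + A) v = v + A v := rfl
  rw [hu, hv, inner_add_left, inner_add_right, inner_add_right]
  have h1 : |⟪u, A v⟫| ≤ ‖u‖ * (α * ‖v‖) := (abs_real_inner_le_norm _ _).trans (mul_le_mul_of_nonneg_left hAv (norm_nonneg _))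
  have h2 : |⟪A u, v⟫| ≤ (α * ‖u‖) * ‖v‖ := (abs_real_inner_le_norm _ _).trans (mul_le_mul_of_nonneg_right hAu (norm_nonneg _))
  have h3 : |⟪A u, A v⟫| ≤ (α * ‖u‖) * (α * ‖v‖) :=
    (abs_real_inner_le_norm _ _).trans (mul_le_mul hAu hAv (norm_nonneg _) (mul_nonneg hα0 (norm_nonneg _)))
  have hre : ⟪u, v⟫ + ⟪u, A v⟫ + (⟪A u, v⟫ + ⟪A u, A v⟫) - ⟪u, v⟫ = ⟪u, A v⟫ + ⟪A u, v⟫ + ⟪A u, A v⟫ := by ring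
  rw [hre]
  calc |⟪u, A v⟫ + ⟪A u, v⟫ + ⟪A u, A v⟫| ≤ |⟪u, A v⟫| + |⟪A u, v⟫| + |⟪A u, A v⟫| := abs_add_three _ _ _
    _ ≤ ‖u‖ * (α * ‖v‖) + (α * ‖u‖) * ‖v‖ + (α * ‖u‖) * (α * ‖v‖) := add_le_add (add_le_add h1 h2) h3
    _ = (2 * α + α ^ 2) * (‖u‖ * ‖v‖) := by ring

/-- Diagonal Gram entries under the recut: `γ'_aa ≤ (1+α)²·γ_aa`. [formal bookkeeping] -/
theorem gramE_recut_diag_le (A G : E3 →L[ℝ] E3) {α : ℝ} (hA : ‖A‖ ≤ α) (a : Fin 3) :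
    gramE (((1 : E3 →L[ℝ] E3) + A) * G) a a ≤ (1 + α) ^ 2 * gramE G a a := by
  have h := norm_one_add_apply_le A hA (G (EuclideanSpace.single a (1 : ℝ)))
  have h0 : 0 ≤ ‖((1 : E3 →L[ℝ] E3) + A) (G (EuclideanSpace.single a (1 : ℝ)))‖ := norm_nonneg _
  simp only [gramE, mul_apply_vec, real_inner_self_eq_norm_sq]
  calc ‖((1 : E3 →L[ℝ] E3) + A) (G (EuclideanSpace.single a (1 : ℝ)))‖ ^ 2 ≤ ((1 + α) * ‖G (EuclideanSpace.single a (1 : ℝ))‖) ^ 2 :=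
        pow_le_pow_left₀ h0 h 2
    _ = (1 + α) ^ 2 * ‖G (EuclideanSpace.single a (1 : ℝ))‖ ^ 2 := by ring

/-- Off-diagonal Gram entries under the recut move by at most `(2α+α²)·‖Ge_a‖·‖Ge_b‖`. [formal bookkeeping] -/
theorem abs_gramE_recut_sub_le (A G : E3 →L[ℝ] E3) {α : ℝ} (hA : ‖A‖ ≤ α) (a b : Fin 3) :
    |gramE (((1 : E3 →L[ℝ] E3) + A) * G) a b - gramE G a b| ≤
      (2 * α + α ^ 2) * (‖G (EuclideanSpace.single a (1 : ℝ))‖ * ‖G (EuclideanSpace.single b (1 : ℝ))‖) := by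
  simp only [gramE, mul_apply_vec]
  exact abs_inner_one_add_sub_le A hA _ _

/-- A frame axis of a Gram-window map has length `≤ (1+μ)·d₁`. [formal bookkeeping] -/
theorem norm_col_le_of_gramWindow {d₁ ν μ δ : ℝ} {G : E3 →L[ℝ] E3} (h : GramWindow d₁ ν μ δ G) (hd : 0 ≤ d₁) (hμ : -1 ≤ μ) (a : Fin 3) :
    ‖G (EuclideanSpace.single a (1 : ℝ))‖ ≤ (1 + μ) * d₁ := by
  have h2 : ‖G (EuclideanSpace.single a (1 : ℝ))‖ ^ 2 ≤ ((1 + μ) * d₁) ^ 2 := by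
    have h' := h.2.1 a
    simp only [gramE, real_inner_self_eq_norm_sq] at h'
    exact h'
  have h0 : 0 ≤ (1 + μ) * d₁ := mul_nonneg (by linarith) hd
  nlinarith [norm_nonneg (G (EuclideanSpace.single a (1 : ℝ)))]

/-- ★ **Window transport.**  `GramWindow d₁ ν μ δ G ∧ ‖A‖ ≤ α ⟹ GramWindow ((1+α)d₁) ν μ ((δ + (2α+α²)(1+μ)²)/(1+α)²) ((1+A)G)`:
(V) and (D) are scale-free once the door scale dilates with the recut; the shear literal picks up the ABSOLUTE collar
`(2α+α²)(1+μ)²` (then is re-normalised to the new scale).  SHEAR-COLLAR-104. [formal bookkeeping] -/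
theorem gramWindow_recut {d₁ ν μ δ α : ℝ} {G : E3 →L[ℝ] E3} (A : E3 →L[ℝ] E3) (hA : ‖A‖ ≤ α) (hd : 0 ≤ d₁) (hμ : -1 ≤ μ)
    (h : GramWindow d₁ ν μ δ G) :
    GramWindow ((1 + α) * d₁) ν μ ((δ + (2 * α + α ^ 2) * (1 + μ) ^ 2) / (1 + α) ^ 2) (((1 : E3 →L[ℝ] E3) + A) * G) := by
  have hα0 : 0 ≤ α := (norm_nonneg A).trans hA
  have hα1 : (0 : ℝ) < (1 + α) ^ 2 := by positivity
  refine ⟨?_, fun a => ?_, fun a b hab => ?_⟩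
  · calc ∑ a, gramE (((1 : E3 →L[ℝ] E3) + A) * G) a a ≤ ∑ a, (1 + α) ^ 2 * gramE G a a :=
          Finset.sum_le_sum fun a _ => gramE_recut_diag_le A G hA a
      _ = (1 + α) ^ 2 * ∑ a, gramE G a a := (Finset.mul_sum _ _ _).symm
      _ ≤ (1 + α) ^ 2 * (3 * ((1 + ν) * d₁) ^ 2) := mul_le_mul_of_nonneg_left h.1 hα1.le
      _ = 3 * ((1 + ν) * ((1 + α) * d₁)) ^ 2 := by ring
  · calc gramE (((1 : E3 →L[ℝ] E3) + A) * G) a a ≤ (1 + α) ^ 2 * gramE G a a := gramE_recut_diag_le A G hA a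
      _ ≤ (1 + α) ^ 2 * ((1 + μ) * d₁) ^ 2 := mul_le_mul_of_nonneg_left (h.2.1 a) hα1.le
      _ = ((1 + μ) * ((1 + α) * d₁)) ^ 2 := by ring
  · have hu := norm_col_le_of_gramWindow h hd hμ a
    have hv := norm_col_le_of_gramWindow h hd hμ b
    have h0 : 0 ≤ (1 + μ) * d₁ := mul_nonneg (by linarith) hd
    have huv : ‖G (EuclideanSpace.single a (1 : ℝ))‖ * ‖G (EuclideanSpace.single b (1 : ℝ))‖ ≤ ((1 + μ) * d₁) ^ 2 := by
      calc _ ≤ ((1 + μ) * d₁) * ((1 + μ) * d₁) := mul_le_mul hu hv (norm_nonneg _) h0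
        _ = ((1 + μ) * d₁) ^ 2 := by ring
    have hdiff := abs_gramE_recut_sub_le A G hA a b
    have hab' := h.2.2 a b hab
    have h2α : 0 ≤ 2 * α + α ^ 2 := by positivity
    have hx := abs_sub_abs_le_abs_sub (gramE (((1 : E3 →L[ℝ] E3) + A) * G) a b) (gramE G a b)
    have hfin : |gramE (((1 : E3 →L[ℝ] E3) + A) * G) a b| ≤ δ * d₁ ^ 2 + (2 * α + α ^ 2) * ((1 + μ) * d₁) ^ 2 := by
      nlinarith [mul_le_mul_of_nonneg_left huv h2α]
    rw [div_mul_eq_mul_div, le_div_iff₀ hα1]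
    calc |gramE (((1 : E3 →L[ℝ] E3) + A) * G) a b| * (1 + α) ^ 2 ≤ (δ * d₁ ^ 2 + (2 * α + α ^ 2) * ((1 + μ) * d₁) ^ 2) * (1 + α) ^ 2 :=
        mul_le_mul_of_nonneg_right hfin hα1.le
      _ = (δ + (2 * α + α ^ 2) * (1 + μ) ^ 2) * ((1 + α) * d₁) ^ 2 := by ring

/-- The Gram window is monotone in the SCALE `d₁` (for `ν, μ ≥ −1`, `δ ≥ 0`). [formal bookkeeping] -/
theorem gramWindow_mono_scale {d d' ν μ δ : ℝ} {G : E3 →L[ℝ] E3} (hd : 0 ≤ d) (hdd : d ≤ d') (hν : -1 ≤ ν) (hμ : -1 ≤ μ) (hδ : 0 ≤ δ)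
    (h : GramWindow d ν μ δ G) : GramWindow d' ν μ δ G := by
  obtain ⟨hV, hD, hS⟩ := h
  have h1 : ((1 + ν) * d) ^ 2 ≤ ((1 + ν) * d') ^ 2 :=
    pow_le_pow_left₀ (mul_nonneg (by linarith) hd) (mul_le_mul_of_nonneg_left hdd (by linarith)) 2
  have h2 : ((1 + μ) * d) ^ 2 ≤ ((1 + μ) * d') ^ 2 :=
    pow_le_pow_left₀ (mul_nonneg (by linarith) hd) (mul_le_mul_of_nonneg_left hdd (by linarith)) 2
  have h3 : δ * d ^ 2 ≤ δ * d' ^ 2 := mul_le_mul_of_nonneg_left (pow_le_pow_left₀ hd hdd 2) hδ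
  exact ⟨hV.trans (by linarith), fun a => (hD a).trans h2, fun a b hab => (hS a b hab).trans h3⟩

/-- **`WinRW Wf Wh`** — the UNIVERSAL window predicate of an RW host: EVERY RW presentation `(φ, b₀, G, ξ, s)` in the interior box
(`b₀ ∈ bends0`, `‖G − 1‖ ≤ 9/50`, `‖ξ‖ ≤ 1/10`, separation `3/4 @ 16`, radius `133/10`) has its generating map in the window
(`Wf G` for fcc, `Wh G` for hcp).  On RW hosts it implies the record (existential) `IsWindowBall Wf Wh bends0 (133/10)`
(`isWindowBall_of_winRW`); it is the source-side door window that TRANSPORTS (`recutStable_winRW`). -/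
def WinRW (Wf Wh : (E3 →L[ℝ] E3) → Prop) : ChartFam := fun M₀ z₀ c₀ =>
  ∀ (φ : Bool) (b₀ : E3 → E3) (G : E3 →L[ℝ] E3) (ξ : E3) (s : Fin M₀ → E3), b₀ ∈ bends0 → ‖G - 1‖ ≤ 9 / 50 → ‖ξ‖ ≤ 1 / 10 →
    WindowSep φ b₀ G ξ 16 (3 / 4) → Set.range s = homRange φ G ξ (133 / 10) (s c₀) → (∀ k, z₀ k - z₀ c₀ = b₀ (s k - s c₀)) →
    cond φ (Wf G) (Wh G)

/-- ★ **Window-clause transport**: if the windows transport under `G ↦ (1+A)G` (`‖A‖ ≤ α ≤ 1/50`), every `α`-recut of a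
`WinRW Wf Wh`-host is an `IsWindowBall Wf' Wh' bends1 (133/10)`-host (presented by the conjugate bending over the re-cut window,
…RecutBuild `presentedBy_bent`; matrix box `‖(1+A)G − 1‖ ≤ 1/4` by …AffineCut `norm_recut_matrix_sub_one_le_fifty`). [formal bookkeeping] -/
theorem recutStable_winRW {Wf Wh Wf' Wh' : (E3 →L[ℝ] E3) → Prop} {α : ℝ} (hα : α ≤ 1 / 50)
    (hf : ∀ (G A : E3 →L[ℝ] E3), ‖A‖ ≤ α → Wf G → Wf' (((1 : E3 →L[ℝ] E3) + A) * G))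
    (hh : ∀ (G A : E3 →L[ℝ] E3), ‖A‖ ≤ α → Wh G → Wh' (((1 : E3 →L[ℝ] E3) + A) * G)) :
    RecutStable (WinRW Wf Wh) (fun _ z₁ c₁ => IsWindowBall Wf' Wh' bends1 (133 / 10) z₁ c₁) α := by
  intro M₀ z₀ c₀ hz A hA M₁ z₁ c₁ hr
  obtain ⟨-, -, -, φ, b₀, b₁, G, ξ, s, w, hb₀, hb₁, hG, hξ, hW, hs, hzs, -, -, hwr, hwc, hz₁⟩ := hr
  have hwin := hz φ b₀ G ξ s hb₀ hG hξ hW hs hzs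
  have hA50 : ‖A‖ ≤ 1 / 50 := hA.trans hα
  have hb₁0 : b₁ 0 = 0 := polyBend_zero (q₂ := 11 / 2000) (q₃ := 11 / 20000) (by simpa [bends1] using hb₁)
  have hP : PresentedBy φ b₁ (((1 : E3 →L[ℝ] E3) + A) * G) ξ (133 / 10) (fun j => z₁ c₁ + b₁ (w j)) c₁ :=
    presentedBy_bent hb₁0 (norm_recut_matrix_sub_one_le_fifty hG hA50) (hξ.trans (by norm_num)) hwr hwc (z₁ c₁)
  have hwin' : cond φ (Wf' (((1 : E3 →L[ℝ] E3) + A) * G)) (Wh' (((1 : E3 →L[ℝ] E3) + A) * G)) := by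
    cases φ
    · exact hh G A hA hwin
    · exact hf G A hA hwin
  have hz₁' : z₁ = fun j => z₁ c₁ + b₁ (w j) := funext hz₁
  have key : IsWindowBall Wf' Wh' bends1 (133 / 10) (fun j => z₁ c₁ + b₁ (w j)) c₁ := isWindowBall_of_presentedBy hb₁ hP hwin'
  rw [← hz₁'] at key
  exact key

/-- On an RW host the universal window predicate implies the record one. [formal bookkeeping] -/
theorem isWindowBall_of_winRW {Wf Wh : (E3 →L[ℝ] E3) → Prop} {z₀ : Fin M₀ → E3} {c₀ : Fin M₀} (hI : ChartFamilyRW M₀ z₀ c₀)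
    (hw : WinRW Wf Wh M₀ z₀ c₀) : IsWindowBall Wf Wh bends0 (133 / 10) z₀ c₀ := by
  obtain ⟨φ, b₀, G, ξ, hb₀, hP₀, hGm, hξ, hW⟩ := hI.2
  obtain ⟨hG4, hξ4, s, hs, hzs⟩ := hP₀
  exact isWindowBall_of_presentedBy hb₀ ⟨hG4, hξ4, s, hs, hzs⟩
    (hw φ b₀ G ξ s hb₀ (hGm.trans (by norm_num [beta0])) (hξ.trans (by norm_num [xi0])) (by simpa only [sep0] using hW) hs hzs)

/-- The UNIVERSAL shear door sits inside the record shear door (…ShearDoorA) inside any RW ambient family. [formal bookkeeping] -/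
theorem famAnd_door_winRW_le_shearDoor {𝓘 : ChartFam} (h𝓘 : FamilyLE 𝓘 ChartFamilyRW) {d η : ℝ} {Wf Wh : (E3 →L[ℝ] E3) → Prop} :
    FamilyLE (famAnd 𝓘 (famAnd (Door d η) (WinRW Wf Wh))) (famAnd 𝓘 (ShearDoor d η bends0 Wf Wh)) :=
  fun M₀ z₀ c₀ h => ⟨h.1, h.2.1, isWindowBall_of_winRW (h𝓘 M₀ z₀ c₀ h.1) h.2.2⟩

/-! ## §5. The record cells for the hysteresis bookkeeping -/

/-- ★ **Shear-door transport** (Gram shape): `Door d₁ η ∧ WinRW (Gram d₁ ν μ δ) (Gram d₁ νh μh δh)` `↦`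
«a neighbour within `(1+α)d₁`» `∧ IsWindowBall (Gram ((1+α)d₁) ν μ δ⁺) (Gram ((1+α)d₁) νh μh δh⁺) bends1 (133/10)`. [formal bookkeeping] -/
theorem recutStable_doorGram {d₁ η ν μ δ νh μh δh α : ℝ} (hα : α ≤ 1 / 50) (hd0 : 0 ≤ d₁) (hd : d₁ ≤ 3) (hμ : -1 ≤ μ) (hμh : -1 ≤ μh) :
    RecutStable (famAnd (Door d₁ η) (WinRW (GramWindow d₁ ν μ δ) (GramWindow d₁ νh μh δh)))
      (famAnd (fun _ z₁ c₁ => ∃ a, a ≠ c₁ ∧ dist (z₁ a) (z₁ c₁) ≤ (1 + α) * d₁)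
        (fun _ z₁ c₁ => IsWindowBall (GramWindow ((1 + α) * d₁) ν μ ((δ + (2 * α + α ^ 2) * (1 + μ) ^ 2) / (1 + α) ^ 2))
          (GramWindow ((1 + α) * d₁) νh μh ((δh + (2 * α + α ^ 2) * (1 + μh) ^ 2) / (1 + α) ^ 2)) bends1 (133 / 10) z₁ c₁)) α :=
  (recutStable_door_near hα hd).and
    (recutStable_winRW hα (fun _ A hA hG => gramWindow_recut A hA hd0 hμ hG) (fun _ A hA hG => gramWindow_recut A hA hd0 hμh hG))

/-- Target-side upgrade into the record shear door: goodness from the competitor family (`η₁ ≤ η`), scale and shear literals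
relaxed monotonically. [formal bookkeeping] -/
theorem target_le_shearDoorGram {𝓑 : Set (E3 → E3)} {η₁ η d d' ν μ δ δ' νh μh δh δh' : ℝ} (hη : η₁ ≤ η) (hd0 : 0 ≤ d) (hdd : d ≤ d')
    (hν : -1 ≤ ν) (hμ : -1 ≤ μ) (hνh : -1 ≤ νh) (hμh : -1 ≤ μh) (hδ0 : 0 ≤ δ) (hδ : δ ≤ δ') (hδh0 : 0 ≤ δh) (hδh : δh ≤ δh') :
    FamilyLE (famAnd (compFamilyW 𝓑 η₁) (famAnd (fun _ z₁ c₁ => ∃ a, a ≠ c₁ ∧ dist (z₁ a) (z₁ c₁) ≤ d)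
        (fun _ z₁ c₁ => IsWindowBall (GramWindow d ν μ δ) (GramWindow d νh μh δh) 𝓑 (133 / 10) z₁ c₁)))
      (famAnd (compFamilyW 𝓑 η₁) (ShearDoorGram d' η 𝓑 ν μ δ' νh μh δh')) := by
  intro M₁ z₁ c₁ h
  obtain ⟨a, ha, hda⟩ := h.2.1
  refine ⟨h.1, ⟨⟨a, ha, hda.trans hdd⟩, goodAtScale_mono hη h.1.2.2.2.2⟩, isWindowBall_mono (fun G hG => ?_) (fun G hG => ?_) h.2.2⟩
  · exact gramWindow_mono (hd0.trans hdd) hν hμ le_rfl le_rfl hδ (gramWindow_mono_scale hd0 hdd hν hμ hδ0 hG)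
  · exact gramWindow_mono (hd0.trans hdd) hνh hμh le_rfl le_rfl hδh (gramWindow_mono_scale hd0 hdd hνh hμh hδh0 hG)

/-- ★ **DOOR cell, recut-stable form** (generic literals): N-family inside `ChartFamilyRW ∧ Door d₁ η ∧ WinRW (Gram) (Gram)`,
target `famAnd (compFamilyW bends1 η₁) (ShearDoorGram d₁' η bends1 ν μ δ' νh μh δh')` with `(1 + 3/160)·d₁ ≤ d₁'` and the shear
literals relaxed by the collar; balance `affBal r`, tube `tauA`, table `affTol (1/25) (1/52)`. [formal bookkeeping] -/
theorem balancedRefit_affBal_shearDoorGram {𝓘_N : ChartFam} {d₁ d₁' η ν μ δ δ' νh μh δh δh' : ℝ}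
    (hN : FamilyLE 𝓘_N (famAnd ChartFamilyRW (famAnd (Door d₁ η) (WinRW (GramWindow d₁ ν μ δ) (GramWindow d₁ νh μh δh)))))
    (hd0 : 0 ≤ d₁) (hd : d₁ ≤ 3) (hd' : (1 + 3 / 160) * d₁ ≤ d₁') (hν : -1 ≤ ν) (hμ : -1 ≤ μ) (hνh : -1 ≤ νh) (hμh : -1 ≤ μh)
    (hδ0 : 0 ≤ δ) (hδh0 : 0 ≤ δh) (hδ' : (δ + (2 * (3 / 160) + (3 / 160) ^ 2) * (1 + μ) ^ 2) / (1 + 3 / 160) ^ 2 ≤ δ')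
    (hδh' : (δh + (2 * (3 / 160) + (3 / 160) ^ 2) * (1 + μh) ^ 2) / (1 + 3 / 160) ^ 2 ≤ δh')
    {r κ : ℝ} (hr : r ≤ 63 / 10) (hκ0 : 0 ≤ κ) (hκ : κ ≤ 15 / 32) {T₀ : SlackTab} (hR : MomentRoom 𝓘_N r κ (1 / 25) T₀)
    {η₁ : ℝ} (hη : η₁ ≤ η) (hG : RecutStable 𝓘_N (lowLevel η₁) (3 / 160)) {ρ ε η₂ : ℝ} :
    BalancedRefit 𝓘_N (famAnd (compFamilyW bends1 η₁) (ShearDoorGram d₁' η bends1 ν μ δ' νh μh δh')) (affBal r) ρ ε η₂ (1 / 25) T₀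
      tauA (affTol (1 / 25) (1 / 52)) := by
  have hS := (recutStable_doorGram (η := η) (ν := ν) (δ := δ) (νh := νh) (δh := δh) (α := 3 / 160) (by norm_num) hd0 hd hμ hμh).mono
    (fun M₀ z₀ c₀ h => (hN M₀ z₀ c₀ h).2) (fun _ _ _ h => h) le_rfl
  have hB := balancedRefit_affBal_stable (fun M₀ z₀ c₀ h => (hN M₀ z₀ c₀ h).1) hr hκ0 hκ hR hG hS (ρ := ρ) (ε := ε) (η₂ := η₂)
  refine BalancedRefit.mono_target hB (target_le_shearDoorGram hη (by positivity) hd' hν hμ hνh hμh ?_ hδ' ?_ hδh')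
  · positivity
  · positivity

/-- ★ **DOOR cell at the record literals** (#41 `hRD` with `𝓣D := famAnd CompFamilyW 𝓡⁺`): source door
`𝓡ᵁ := Door (24/25) (9/100) ∧ WinRW (Gram (24/25) ν μ δ) (Gram (24/25) νh μh δh)` inside `famAnd (famAnd 𝓘₀ (Dense dA)) 𝓡ᵁ`,
target `famAnd CompFamilyW (ShearDoorGram (489/500) (9/100) bends1 ν μ δ' νh μh δh')` whenever
`25600·δ + 969·(1+μ)² ≤ 26569·δ'` (same for the hcp literals); admissibility `(26/5, 1/100, 1/8)`, `affBal (24/5)`, ROOM at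
`κ ≤ 15/32`, target goodness `eta30` via `RecutGoodA`. [formal bookkeeping] -/
theorem balancedRefit_affBal_shearDoorGram_record {𝓘₀ : ChartFam} (h𝓘₀ : FamilyLE 𝓘₀ ChartFamilyRW) {dA ν μ δ δ' νh μh δh δh' κ : ℝ}
    (hν : -1 ≤ ν) (hμ : -1 ≤ μ) (hνh : -1 ≤ νh) (hμh : -1 ≤ μh) (hδ0 : 0 ≤ δ) (hδh0 : 0 ≤ δh)
    (hδ' : 25600 * δ + 969 * (1 + μ) ^ 2 ≤ 26569 * δ') (hδh' : 25600 * δh + 969 * (1 + μh) ^ 2 ≤ 26569 * δh')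
    (hκ0 : 0 ≤ κ) (hκ : κ ≤ 15 / 32)
    (hR : MomentRoom (famAnd (famAnd 𝓘₀ (Dense dA)) (famAnd (Door (24 / 25) (9 / 100)) (WinRW (GramWindow (24 / 25) ν μ δ) (GramWindow (24 / 25) νh μh δh))))
      (24 / 5) κ (1 / 25) (constTol (1 / 25)))
    (hG : RecutGoodA (famAnd (famAnd 𝓘₀ (Dense dA)) (famAnd (Door (24 / 25) (9 / 100)) (WinRW (GramWindow (24 / 25) ν μ δ) (GramWindow (24 / 25) νh μh δh))))
      eta30) :
    BalancedRefit (famAnd (famAnd 𝓘₀ (Dense dA)) (famAnd (Door (24 / 25) (9 / 100)) (WinRW (GramWindow (24 / 25) ν μ δ) (GramWindow (24 / 25) νh μh δh))))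
      (famAnd CompFamilyW (ShearDoorGram (489 / 500) (9 / 100) bends1 ν μ δ' νh μh δh')) (affBal (24 / 5)) (26 / 5) (1 / 100) (1 / 8) (1 / 25)
      (constTol (1 / 25)) tauA (affTol (1 / 25) (1 / 52)) := by
  refine balancedRefit_affBal_shearDoorGram (fun M₀ z₀ c₀ h => ⟨h𝓘₀ M₀ z₀ c₀ h.1.1, h.2⟩) (by norm_num) (by norm_num) (by norm_num) hν hμ hνh hμh
    hδ0 hδh0 ?_ ?_ (by norm_num) hκ0 hκ hR (by norm_num [eta30]) (recutStable_lowLevel_of_recutGoodA hG)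
  · have h1 : (δ + (2 * (3 / 160) + (3 / 160 : ℝ) ^ 2) * (1 + μ) ^ 2) / (1 + 3 / 160) ^ 2 = (25600 * δ + 969 * (1 + μ) ^ 2) / 26569 := by
      field_simp; ring
    rw [h1, div_le_iff₀ (by norm_num : (0 : ℝ) < 26569)]
    linarith
  · have h1 : (δh + (2 * (3 / 160) + (3 / 160 : ℝ) ^ 2) * (1 + μh) ^ 2) / (1 + 3 / 160) ^ 2 = (25600 * δh + 969 * (1 + μh) ^ 2) / 26569 := by
      field_simp; ring
    rw [h1, div_le_iff₀ (by norm_num : (0 : ℝ) < 26569)]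
    linarith

/-- ★ **BAND cell, recut-stable form**: N-family inside `ChartFamilyRW ∧ Dense d` (`d ≤ 3`), target
`famAnd (compFamilyW bends1 η₁) (Dense d')` for `(1 + 3/160)·d ≤ d'`. [formal bookkeeping] -/
theorem balancedRefit_affBal_dense {𝓘_N : ChartFam} {d d' : ℝ} (hN : FamilyLE 𝓘_N (famAnd ChartFamilyRW (Dense d))) (hd : d ≤ 3)
    (hd' : (1 + 3 / 160) * d ≤ d') {r κ : ℝ} (hr : r ≤ 63 / 10) (hκ0 : 0 ≤ κ) (hκ : κ ≤ 15 / 32) {T₀ : SlackTab}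
    (hR : MomentRoom 𝓘_N r κ (1 / 25) T₀) {η₁ : ℝ} (hG : RecutStable 𝓘_N (lowLevel η₁) (3 / 160)) {ρ ε η₂ : ℝ} :
    BalancedRefit 𝓘_N (famAnd (compFamilyW bends1 η₁) (Dense d')) (affBal r) ρ ε η₂ (1 / 25) T₀ tauA (affTol (1 / 25) (1 / 52)) := by
  have hS := (recutStable_dense (α := 3 / 160) (by norm_num) hd).mono (fun M₀ z₀ c₀ h => (hN M₀ z₀ c₀ h).2) (dense_mono hd') le_rfl
  exact balancedRefit_affBal_stable (fun M₀ z₀ c₀ h => (hN M₀ z₀ c₀ h).1) hr hκ0 hκ hR hG hS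

/-- ★ **BAND cell at the record literals** (#41 `hRB` with `𝓣B := famAnd CompFamilyW (Dense dB')`, any source door `𝓡`):
`dB ≤ 3`, `(163/160)·dB ≤ dB'` (record `dB = 1009/1000`, `dB' = 257/250`). [formal bookkeeping] -/
theorem balancedRefit_affBal_dense_record {𝓘₀ 𝓡 : ChartFam} (h𝓘₀ : FamilyLE 𝓘₀ ChartFamilyRW) {dA dB dB' κ : ℝ} (hdB : dB ≤ 3)
    (hdB' : (163 / 160) * dB ≤ dB') (hκ0 : 0 ≤ κ) (hκ : κ ≤ 15 / 32)
    (hR : MomentRoom (famAnd (famAndNot (famAnd 𝓘₀ (Dense dA)) 𝓡) (Dense dB)) (24 / 5) κ (1 / 25) (constTol (1 / 25)))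
    (hG : RecutGoodA (famAnd (famAndNot (famAnd 𝓘₀ (Dense dA)) 𝓡) (Dense dB)) eta30) :
    BalancedRefit (famAnd (famAndNot (famAnd 𝓘₀ (Dense dA)) 𝓡) (Dense dB)) (famAnd CompFamilyW (Dense dB')) (affBal (24 / 5)) (26 / 5) (1 / 100) (1 / 8)
      (1 / 25) (constTol (1 / 25)) tauA (affTol (1 / 25) (1 / 52)) :=
  balancedRefit_affBal_dense (fun M₀ z₀ c₀ h => ⟨h𝓘₀ M₀ z₀ c₀ h.1.1.1, h.2⟩) hdB (by linarith) (by norm_num) hκ0 hκ hR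
    (recutStable_lowLevel_of_recutGoodA hG)

/-- Record arithmetic: the transported door scale and band threshold. [formal bookkeeping] -/
example : (1 + 3 / 160 : ℝ) * (24 / 25) = 489 / 500 ∧ (163 / 160 : ℝ) * (1009 / 1000) ≤ 257 / 250 := by norm_num

/-! ## §6. Vacuity of the unexercised target classes -/

/-- A pair-kernel certificate over an EMPTY family holds. [formal bookkeeping] -/
theorem pairKernelCert_of_forall_not {𝓘 : ChartFam} (h : ∀ (M₀ : ℕ) (z₀ : Fin M₀ → E3) (c₀ : Fin M₀), ¬𝓘 M₀ z₀ c₀) {𝓑 : BalPred}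
    {τ₁ κ σ τ : ℝ} {T₁ X T : SlackTab} {H : HessTab} {F : ForceTab} {B : PairTab} : PairKernelCert 𝓘 𝓑 τ₁ T₁ κ σ H F X τ T B :=
  fun _ _ _ M₀ z₀ c₀ _ hch _ _ => (h M₀ z₀ c₀ (chartByG_mem hch)).elim

/-- A slaving enclosure over an EMPTY family holds. [formal bookkeeping] -/
theorem slavingEnclosureG_of_forall_not {𝓘 : ChartFam} (h : ∀ (M₀ : ℕ) (z₀ : Fin M₀ → E3) (c₀ : Fin M₀), ¬𝓘 M₀ z₀ c₀) {𝓑 : BalPred}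
    {ρ ε η₂ τ₁ κ σ : ℝ} {T₁ X : SlackTab} {H : HessTab} {F : ForceTab} : SlavingEnclosureG 𝓘 𝓑 ρ ε η₂ τ₁ T₁ κ σ H F X :=
  fun _ _ _ M₀ z₀ c₀ _ _ _ _ _ _ hch _ => (h M₀ z₀ c₀ (chartByG_mem hch)).elim

/-- `(𝓣 ∧ 𝓡) ∧ ¬𝓡` is empty. [formal bookkeeping] -/
theorem not_famAndNot_famAnd {𝓣 𝓡 : ChartFam} (M₀ : ℕ) (z₀ : Fin M₀ → E3) (c₀ : Fin M₀) : ¬famAndNot (famAnd 𝓣 𝓡) 𝓡 M₀ z₀ c₀ :=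
  fun h => h.2 h.1.2

/-- `((𝓣 ∧ 𝓡) ∧ ¬𝓡) ∧ 𝓟` is empty (#41's door-cell class 2 for `𝓣D := famAnd 𝓣 𝓡⁺`, `𝓡' := 𝓡⁺`). [formal bookkeeping] -/
theorem not_famAnd_famAndNot_famAnd {𝓣 𝓡 𝓟 : ChartFam} (M₀ : ℕ) (z₀ : Fin M₀ → E3) (c₀ : Fin M₀) :
    ¬famAnd (famAndNot (famAnd 𝓣 𝓡) 𝓡) 𝓟 M₀ z₀ c₀ :=
  fun h => h.1.2 h.1.1.2

/-- `((𝓣 ∧ 𝓡) ∧ ¬𝓡) ∧ ¬𝓟` is empty (#41's door-cell class 3). [formal bookkeeping] -/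
theorem not_famAndNot_famAndNot_famAnd {𝓣 𝓡 𝓟 : ChartFam} (M₀ : ℕ) (z₀ : Fin M₀ → E3) (c₀ : Fin M₀) :
    ¬famAndNot (famAndNot (famAnd 𝓣 𝓡) 𝓡) 𝓟 M₀ z₀ c₀ :=
  fun h => h.1.2 h.1.1.2

/-- `((𝓣 ∧ 𝓟) ∧ ¬𝓡) ∧ ¬𝓟` is empty (#41's band-cell class 3 for `𝓣B := famAnd 𝓣 𝓟'`). [formal bookkeeping] -/
theorem not_famAndNot_famAndNot_famAnd' {𝓣 𝓡 𝓟 : ChartFam} (M₀ : ℕ) (z₀ : Fin M₀ → E3) (c₀ : Fin M₀) :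
    ¬famAndNot (famAndNot (famAnd 𝓣 𝓟) 𝓡) 𝓟 M₀ z₀ c₀ :=
  fun h => h.2 h.1.1.2

/-- `(𝓣 ∧ ¬𝓡) ∧ ¬𝓟` is empty whenever `𝓣 ⊆ 𝓟` (class 3 for a target family confined INSIDE the dense sector, e.g.
`𝓣D := famAnd 𝓣 𝓡⁺` with `𝓡⁺ ⊆ Dense dB⁺` and the table's `𝓡'` = the record door — the «collar read at `B₂`» instantiation). [formal bookkeeping] -/
theorem not_famAndNot_famAndNot_of_le {𝓣 𝓡 𝓟 : ChartFam} (hle : FamilyLE 𝓣 𝓟) (M₀ : ℕ) (z₀ : Fin M₀ → E3) (c₀ : Fin M₀) :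
    ¬famAndNot (famAndNot 𝓣 𝓡) 𝓟 M₀ z₀ c₀ :=
  fun h => h.2 (hle M₀ z₀ c₀ h.1.1)

/-- The transported door target sits inside the transported dense sector: `famAnd 𝓣 (ShearDoorGram d₁' η 𝓑 …) ⊆ Dense dB'` for `d₁' < dB'`
(record `489/500 < 257/250`). [formal bookkeeping] -/
theorem famAnd_shearDoorGram_le_dense {𝓣 : ChartFam} {𝓑 : Set (E3 → E3)} {d₁' dB' η ν μ δ νh μh δh : ℝ} (h : d₁' < dB') :
    FamilyLE (famAnd 𝓣 (ShearDoorGram d₁' η 𝓑 ν μ δ νh μh δh)) (Dense dB') :=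
  fun M₀ z₀ c₀ hz => dense_of_shearDoor h M₀ z₀ c₀ hz.2

end Summit.AtomisticToContinuum.Crystallization.Theorems.FrustratedLawDichotomyStrainedPatchSectorTransport
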